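import Literature.Analysis.FluidPDE.MildSolutionHeatFlowProofs
import Literature.Analysis.FluidPDE.KochTataruIntegralOfClass
import Literature.Analysis.FluidPDE.OseenHeatLpBounds
import Literature.Analysis.UnboundedOperators.HeatFlowCalculus
import HarnessLib

/-!
# The free evolution `t ↦ e^{νtΔ}u₀` of `Lᵖ` data: the curve in `C([0,∞); Lᵖ)`, measurability,
# divergence freeness, Kato's weights

Analysis/FluidPDE support file for Kato's `L³` theory of mild solutions (Kato, Math. Z. 187 (1984),
Thm. 1; Lemarié-Rieusset 2016, Thm. 7.5 — the programme discharging `kato_local_L3`,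
`MildL3Smooth.lean`, and `kato_solution_le_div_sqrt`, `RusinSverakLeraySolutions.lean`). Kato's
solution is `u = U - B(u,u)` with the free term `U(t) = e^{νtΔ}u₀` (the tree's `heatFlow u₀ (ν t)`,
`MildSolution.lean`: `e^{τΔ}` for all `τ ≥ 0`, `e^{0Δ} = id`). The four clauses of the Kato class
(`IsKatoSolutionOn`: duality-form mild solution, `C([0,T); L³)`, `u 0 = u₀`, joint measurability)
and Kato's weighted bounds are, for the free term, statements about the heat semigroup on `Lᵖ`,
which this file packages (any dimension unless stated):

* `MemLp.isPolynomiallyTempered` — `Lᵖ` fields, `1 ≤ p ≤ ∞`, are polynomially tempered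
  (Hölder against the weight `(1 + ‖y‖²)^{-(d+1)} ∈ L¹ ∩ L^∞`), whence
  `IsWeaklyDivFree.heatFlow_of_memLp` — **the free evolution of weakly divergence-free `Lᵖ` data
  is weakly divergence free** (the tree's `isWeaklyDivFree_heatExtension` for tempered data;
  Lemarié-Rieusset 2016, Cor. 6.2: `div e^{νtΔ}u₀ = e^{νtΔ} div u₀ = 0`);
* `eLpNorm_heatFlow_sub_heatFlow_le` — `‖e^{tΔ}f - e^{t₀Δ}f‖_p ≤ ‖e^{|t-t₀|Δ}f - f‖_p` (semigroup
  law and `Lᵖ` contraction), and `continuousInLpOn_heatFlow` — **`t ↦ e^{νtΔ}f ∈ C([0,∞); Lᵖ)`**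
  for `f ∈ Lᵖ`, `1 ≤ p < ∞`, `ν ≥ 0` (strong continuity at `0`, Stein 1970, Ch. III §2 Thm. 2;
  Kato 1984, (2.2): `u₀(t) = e^{-tA}a ∈ BC([0,∞); PL³)`), in the tree's `ContinuousInLpOn`;
* `aestronglyMeasurable_uncurry_heatFlow` — joint measurability of `(t, x) ↦ e^{νtΔ}f(x)` on the
  strip `(0, T) × E` (joint continuity on `t > 0`, `continuousOn_uncurry_heatExtension_of_memLp`);
* `exists_eLpNorm_six_heatFlow_le`, `exists_eLpNorm_top_heatFlow_le` (dimension three) — Kato's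
  weights for the free term, `‖e^{νtΔ}f‖₆ ≤ C (νt)^{-1/4} ‖f‖₃` and `‖e^{νtΔ}f‖_∞ ≤ C (νt)^{-1/2} ‖f‖₃`
  (Kato 1984, (2.2)–(2.3) with `q = 6, ∞`; the tree's `eLpNorm_heatExtension_le_rpow_holds`).

## Mathlib / tree search

Tree: `heatFlow`, `heatFlow_of_pos`, `heatFlow_zero`, `heatFlow_of_nonpos` (`MildSolution.lean`),
`heatFlow_heatFlow_holds`, `memLp_heatFlow_holds`, `eLpNorm_heatFlow_le_holds`,
`tendsto_heatFlow_nhdsWithin_zero_holds` (`MildSolutionHeatFlowProofs.lean`),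
`isWeaklyDivFree_heatExtension`, `integrable_inv_one_add_norm_sq_pow_finrank_succ`
(`KochTataruIntegralOfClass.lean`), `memLp_of_memLp_of_memLp_top` (`OseenHeatLpBounds.lean`),
`UnboundedOperators.continuousOn_uncurry_heatExtension_of_memLp` (`HeatFlowCalculus.lean`),
`UnboundedOperators.eLpNorm_heatExtension_le_rpow_holds` (`HeatKernelLpSmoothingProofs.lean`),
`UnboundedOperators.convolutionExistsAt_of_memLp` (`HeatKernel.lean`); `ContinuousInLpOn`
(`LerayHopf.lean`). No `C([0,∞); Lᵖ)` packaging of the heat flow existed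
(`lean search 'continuousInLpOn.*heat'`: none). Mathlib: `MemLp.smul`,
`ConvolutionExistsAt.distrib_sub`, `tendsto_of_tendsto_of_tendsto_of_le_of_le`,
`ContinuousOn.aestronglyMeasurable`.

## References

* T. Kato, *Strong `L^p`-solutions of the Navier–Stokes equation in `ℝ^m`, with applications to
  weak solutions*, Math. Z. 187 (1984) 471–480, (2.2)–(2.3). [Kato1984]
* P. G. Lemarié-Rieusset, *The Navier–Stokes Problem in the 21st Century*, CRC Press 2016,
  doi:10.1201/b19556, Cor. 6.2 and Thm. 7.5 (proof, PDF pp. 155–158). [LemarieRieusset2016]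
* E. M. Stein, *Singular Integrals and Differentiability Properties of Functions* (1970),
  Ch. III §2, Thm. 2. [SteinSingularIntegrals1970]
-/

noncomputable section

open MeasureTheory TopologicalSpace Set Function Filter Topology
open scoped ENNReal NNReal RealInnerProductSpace Convolution

namespace Literature.Analysis.FluidPDE

variable {E : Type*} [NormedAddCommGroup E] [InnerProductSpace ℝ E] [FiniteDimensional ℝ E]
  [MeasurableSpace E] [BorelSpace E]

/-! ### `Lᵖ` data are tempered; the free evolution is weakly divergence free -/

section DivFree

/-- **`Lᵖ` fields are polynomially tempered** (`1 ≤ p ≤ ∞`): the weight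
`w = (1 + ‖y‖²)^{-(d+1)}` is integrable and bounded by `1`, hence in the conjugate class `L^{p'}`,
and `w u₀ ∈ L¹` by Hölder. [folklore] -/
theorem MemLp.isPolynomiallyTempered {u₀ : E → E} {p : ℝ≥0∞} (hp : 1 ≤ p)
    (hu : MemLp u₀ p volume) : IsPolynomiallyTempered u₀ := by
  haveI : p.HolderConjugate (ENNReal.conjExponent p) := .conjExponent hp
  set N : ℕ := Module.finrank ℝ E + 1 with hN
  set w : E → ℝ := fun y => ((1 + ‖y‖ ^ 2) ^ N : ℝ)⁻¹ with hw
  have hw1 : Integrable w volume := integrable_inv_one_add_norm_sq_pow_finrank_succ (E := E)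
  have hwle : ∀ y, ‖w y‖ ≤ 1 := fun y => by
    rw [hw]
    dsimp only
    have h1 : (1 : ℝ) ≤ (1 + ‖y‖ ^ 2) ^ N := one_le_pow₀ (by nlinarith [norm_nonneg y])
    rw [Real.norm_of_nonneg (by positivity)]
    exact inv_le_one_of_one_le₀ h1
  have hwtop : MemLp w ∞ volume := memLp_top_of_bound hw1.aestronglyMeasurable 1
    (Eventually.of_forall hwle)
  have hwq : MemLp w (ENNReal.conjExponent p) volume :=
    memLp_of_memLp_of_memLp_top le_rfl (ENNReal.HolderConjugate.one_le (ENNReal.conjExponent p) p)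
      (memLp_one_iff_integrable.2 hw1) hwtop
  have h : MemLp (w • u₀) 1 volume := MemLp.smul (r := 1) hu hwq
  exact ⟨N, memLp_one_iff_integrable.1 h⟩

/-- **The free evolution of weakly divergence-free `Lᵖ` data is weakly divergence free**
(`1 ≤ p ≤ ∞`, `t > 0`; Lemarié-Rieusset 2016, Cor. 6.2: `div (e^{νtΔ}u₀) = e^{νtΔ}(div u₀) = 0`;
the tree's `isWeaklyDivFree_heatExtension` for tempered data). [cite: LemarieRieusset2016, Cor. 6.2] -/
theorem IsWeaklyDivFree.heatExtension_of_memLp {u₀ : E → E} (hdiv : IsWeaklyDivFree u₀)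
    {p : ℝ≥0∞} (hp : 1 ≤ p) (hu : MemLp u₀ p volume) {t : ℝ} (ht : 0 < t) :
    IsWeaklyDivFree (fun x => UnboundedOperators.heatExtension u₀ t x) :=
  isWeaklyDivFree_heatExtension hdiv (MemLp.isPolynomiallyTempered hp hu) ht

/-- **The free evolution `heatFlow u₀ (ν t)` of weakly divergence-free `Lᵖ` data is weakly
divergence free** for all `ν, t ≥ 0` (at `ν t = 0` it is `u₀` itself). [cite: LemarieRieusset2016, Cor. 6.2] -/
theorem IsWeaklyDivFree.heatFlow_of_memLp {u₀ : E → E} (hdiv : IsWeaklyDivFree u₀)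
    {p : ℝ≥0∞} (hp : 1 ≤ p) (hu : MemLp u₀ p volume) (τ : ℝ) :
    IsWeaklyDivFree (heatFlow u₀ τ) := by
  rcases le_or_gt τ 0 with hτ | hτ
  · rw [heatFlow_of_nonpos _ hτ]
    exact hdiv
  · rw [heatFlow_of_pos _ hτ]
    exact hdiv.heatExtension_of_memLp hp hu hτ

end DivFree

/-! ### The heat flow of `Lᵖ` data as a curve in `C([0,∞); Lᵖ)` -/

section Curve

variable {F : Type*} [NormedAddCommGroup F] [NormedSpace ℝ F] [CompleteSpace F]
variable {f : E → F} {p : ℝ≥0∞}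

omit [CompleteSpace F] in
/-- **The caloric extension of a difference of `Lᵖ` data** (as functions):
`e^{aΔ}(f - g) = e^{aΔ}f - e^{aΔ}g` (both convolutions converge at every point; the pointwise
form is the tree's `heatExtension_sub_of_memLp`, `LerayHopfMildH1.lean`). [folklore] -/
private theorem heatExtension_sub_of_memLp'  {g : E → F} (hf : MemLp f p volume) (hg : MemLp g p volume)
    (hp : 1 ≤ p) {a : ℝ} (ha : 0 < a) :
    UnboundedOperators.heatExtension (f - g) a =
      UnboundedOperators.heatExtension f a - UnboundedOperators.heatExtension g a := by
  haveI : p.HolderConjugate (ENNReal.conjExponent p) := .conjExponent hp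
  have hq : 1 ≤ ENNReal.conjExponent p := ENNReal.HolderConjugate.one_le (ENNReal.conjExponent p) p
  have hK := UnboundedOperators.memLp_heatKernel (E := E) ha hq
  funext x
  have hint : ∀ {h : E → F}, MemLp h p volume →
      Integrable (fun y => UnboundedOperators.heatKernel a y • h (x - y)) volume := fun hh => by
    have h := UnboundedOperators.convolutionExistsAt_of_memLp (ContinuousLinearMap.lsmul ℝ ℝ) hK hh x
    simpa [ConvolutionExistsAt] using h
  rw [Pi.sub_apply, UnboundedOperators.heatExtension_apply, UnboundedOperators.heatExtension_apply,
    UnboundedOperators.heatExtension_apply, ← integral_sub (hint hf) (hint hg)]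
  refine integral_congr_ae (Eventually.of_forall fun y => ?_)
  simp only [Pi.sub_apply, smul_sub]

omit [CompleteSpace F] in
/-- The heat flow of a difference of `Lᵖ` data, for every `τ` (for `τ ≤ 0` it is the identity).
[folklore] -/
theorem heatFlow_sub_of_memLp {g : E → F} (hf : MemLp f p volume) (hg : MemLp g p volume)
    (hp : 1 ≤ p) (τ : ℝ) :
    heatFlow (f - g) τ = heatFlow f τ - heatFlow g τ := by
  rcases le_or_gt τ 0 with hτ | hτ
  · simp only [heatFlow_of_nonpos _ hτ]
  · simp only [heatFlow_of_pos _ hτ]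
    exact heatExtension_sub_of_memLp' hf hg hp hτ

/-- **Increments of the heat flow are controlled by the increment at the origin**:
`‖e^{tΔ}f - e^{t₀Δ}f‖_p ≤ ‖e^{|t - t₀|Δ}f - f‖_p` for `f ∈ Lᵖ`, `1 ≤ p`, `0 ≤ t₀, t` (write the
later time as `e^{min Δ}` of `e^{|t-t₀|Δ}f` by the semigroup law, and use the `Lᵖ` contraction).
[folklore] -/
theorem eLpNorm_heatFlow_sub_heatFlow_le (hf : MemLp f p volume) (hp : 1 ≤ p) {t₀ t : ℝ}
    (ht₀ : 0 ≤ t₀) (ht : 0 ≤ t) :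
    eLpNorm (heatFlow f t - heatFlow f t₀) p volume ≤
      eLpNorm (heatFlow f |t - t₀| - f) p volume := by
  -- the increment at the origin is an `Lᵖ` function
  have hinc : ∀ {s : ℝ}, 0 ≤ s → MemLp (heatFlow f s - f) p volume := fun hs =>
    (memLp_heatFlow_holds hf hp hs).sub hf
  rcases le_total t₀ t with h | h
  · -- `t = (t - t₀) + t₀`
    have hs : 0 ≤ t - t₀ := sub_nonneg.2 h
    rw [abs_of_nonneg hs]
    have hsemi : heatFlow f t = heatFlow (heatFlow f (t - t₀)) t₀ := by
      rw [heatFlow_heatFlow_holds hf hp hs ht₀, sub_add_cancel]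
    have hdiff : heatFlow f t - heatFlow f t₀ = heatFlow (heatFlow f (t - t₀) - f) t₀ := by
      rw [hsemi, heatFlow_sub_of_memLp (memLp_heatFlow_holds hf hp hs) hf hp t₀]
    rw [hdiff]
    exact eLpNorm_heatFlow_le_holds (hinc hs) hp ht₀
  · -- `t₀ = (t₀ - t) + t`
    have hs : 0 ≤ t₀ - t := sub_nonneg.2 h
    rw [abs_sub_comm, abs_of_nonneg hs]
    have hsemi : heatFlow f t₀ = heatFlow (heatFlow f (t₀ - t)) t := by
      rw [heatFlow_heatFlow_holds hf hp hs ht, sub_add_cancel]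
    have hdiff : heatFlow f t - heatFlow f t₀ = -heatFlow (heatFlow f (t₀ - t) - f) t := by
      rw [hsemi, heatFlow_sub_of_memLp (memLp_heatFlow_holds hf hp hs) hf hp t, neg_sub]
    rw [hdiff, eLpNorm_neg]
    exact eLpNorm_heatFlow_le_holds (hinc hs) hp ht

/-- **The free evolution of `Lᵖ` data is a curve in `C([0,∞); Lᵖ)`**: for `f ∈ Lᵖ`,
`1 ≤ p < ∞` and `ν ≥ 0`, `t ↦ e^{νtΔ}f` (`heatFlow f (ν t)`) lies in the tree's class
`ContinuousInLpOn (Ici 0) p` — every slice is in `Lᵖ` and `‖e^{νtΔ}f - e^{νt₀Δ}f‖_p → 0` as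
`t → t₀` within `[0, ∞)`, by `eLpNorm_heatFlow_sub_heatFlow_le` and the strong continuity of the
heat semigroup at the origin (Stein 1970, Ch. III §2, Thm. 2; Kato 1984, (2.2): the free term
`u₀(t) = e^{-tA}a` is in `BC([0,∞); L³)`). [cite: Kato1984, (2.2)] [cite: SteinSingularIntegrals1970, Ch. III §2 Theorem 2] -/
theorem continuousInLpOn_heatFlow (hf : MemLp f p volume) (hp : 1 ≤ p) (hp' : p ≠ ∞) {ν : ℝ}
    (hν : 0 ≤ ν) : ContinuousInLpOn (Ici 0) p (fun t => heatFlow f (ν * t)) := by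
  refine ⟨fun t ht => memLp_heatFlow_holds hf hp (mul_nonneg hν ht), fun t₀ ht₀ => ?_⟩
  have ht₀' : (0 : ℝ) ≤ t₀ := ht₀
  -- the increment at the origin tends to zero along `s(t) = ν |t - t₀| → 0⁺`
  have hG := tendsto_heatFlow_nhdsWithin_zero_holds hf hp hp'
  have hs : Tendsto (fun t : ℝ => ν * |t - t₀|) (𝓝[Ici 0] t₀) (𝓝[≥] 0) := by
    have hc : Continuous fun t : ℝ => ν * |t - t₀| := by fun_prop
    have h0 : (fun t : ℝ => ν * |t - t₀|) t₀ = 0 := by simp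
    refine tendsto_nhdsWithin_of_tendsto_nhds_of_eventually_within _ ?_ ?_
    · rw [← h0]
      exact hc.continuousAt.tendsto.mono_left nhdsWithin_le_nhds
    · exact Eventually.of_forall fun t => mul_nonneg hν (abs_nonneg _)
  have hcomp := hG.comp hs
  have key : ∀ t ∈ Ici (0 : ℝ), eLpNorm (heatFlow f (ν * t) - heatFlow f (ν * t₀)) p volume ≤
      eLpNorm (heatFlow f (ν * |t - t₀|) - f) p volume := by
    intro t ht
    have ht' : (0 : ℝ) ≤ t := ht
    have h := eLpNorm_heatFlow_sub_heatFlow_le hf hp (mul_nonneg hν ht₀') (mul_nonneg hν ht')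
    rwa [← mul_sub, abs_mul, abs_of_nonneg hν] at h
  -- squeeze (the bound is needed only eventually, i.e. on `[0, ∞)`)
  refine tendsto_of_tendsto_of_tendsto_of_le_of_le' tendsto_const_nhds hcomp
    (Eventually.of_forall fun _ => zero_le) ?_
  filter_upwards [self_mem_nhdsWithin] with t ht
  exact key t ht

end Curve

/-! ### Joint measurability of the free evolution on a strip -/

section Measurability

variable {F : Type*} [NormedAddCommGroup F] [NormedSpace ℝ F]
variable {f : E → F} {p : ℝ≥0∞}

/-- **Joint measurability of `(t, x) ↦ e^{νtΔ}f(x)` on the strip `(0, T) × E`** for `f ∈ Lᵖ`,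
`1 ≤ p`, `ν > 0`: on `t > 0` the heat flow is the caloric extension, jointly continuous in
`(t, x)` (`continuousOn_uncurry_heatExtension_of_memLp`). This is the measurability clause of the
Kato class for the free term. [folklore] -/
theorem aestronglyMeasurable_uncurry_heatFlow (hf : MemLp f p volume) (hp : 1 ≤ p) {ν : ℝ}
    (hν : 0 < ν) (T : ℝ) :
    AEStronglyMeasurable (uncurry fun (t : ℝ) (x : E) => heatFlow f (ν * t) x)
      (volume.restrict (Ioo 0 T ×ˢ univ)) := by
  have hcont : ContinuousOn (fun q : ℝ × E => heatFlow f (ν * q.1) q.2) (Ioi 0 ×ˢ univ) := by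
    have h := UnboundedOperators.continuousOn_uncurry_heatExtension_of_memLp hf hp
    have hmap : Continuous fun q : ℝ × E => ((ν * q.1, q.2) : ℝ × E) := by fun_prop
    have h2 := h.comp (hmap.continuousOn (s := Ioi (0 : ℝ) ×ˢ (univ : Set E)))
      (fun q hq => ⟨mul_pos hν hq.1, mem_univ _⟩)
    refine h2.congr fun q hq => ?_
    show heatFlow f (ν * q.1) q.2 = UnboundedOperators.heatExtension f (ν * q.1) q.2
    rw [heatFlow_of_pos _ (mul_pos hν hq.1)]
  have hmeas := hcont.aestronglyMeasurable (μ := (volume : Measure (ℝ × E)))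
    (measurableSet_Ioi.prod MeasurableSet.univ)
  exact hmeas.mono_measure (Measure.restrict_mono (prod_mono Ioo_subset_Ioi_self subset_rfl) le_rfl)

end Measurability

/-! ### Kato's weights for the free term (dimension three) -/

section Weights

variable {F : Type*} [NormedAddCommGroup F] [NormedSpace ℝ F] [CompleteSpace F]
variable (hE : Module.finrank ℝ E = 3)
include hE

/-- **Kato's `L⁶` weight for the free term** (dimension three; Kato 1984, (2.2)–(2.3) with
`q = 6`: `t^{(1-3/q)/2}‖e^{-tA}a‖_q ≤ C‖a‖₃`, `(1 - 3/6)/2 = 1/4`): there is `C = C(E)` with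
`‖e^{τΔ}f‖₆ ≤ C τ^{-1/4} ‖f‖₃` for `f ∈ L³`, `τ > 0` (the tree's `L³ → L⁶` smoothing of the heat
kernel). [cite: Kato1984, (2.2)–(2.3)] -/
theorem exists_eLpNorm_six_heatFlow_le :
    ∃ C : ℝ≥0, ∀ (f : E → F), MemLp f 3 volume → ∀ τ : ℝ, 0 < τ →
      eLpNorm (heatFlow f τ) 6 volume ≤ C * ENNReal.ofReal (τ ^ (-(1 / 4 : ℝ))) * eLpNorm f 3 volume := by
  obtain ⟨C, hC⟩ := UnboundedOperators.eLpNorm_heatExtension_le_rpow_holds E F (p := 3) (q := 6)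
    (by norm_num) (by norm_num)
  refine ⟨C, fun f hf τ hτ => ?_⟩
  have h := hC f hf τ hτ
  have hexp : -((Module.finrank ℝ E : ℝ) / 2) * ((1 / (3 : ℝ≥0∞)).toReal - (1 / (6 : ℝ≥0∞)).toReal) =
      -(1 / 4 : ℝ) := by
    rw [hE]
    norm_num [ENNReal.toReal_div]
  rw [hexp] at h
  rwa [heatFlow_of_pos _ hτ]

/-- **Kato's `L^∞` weight for the free term** (dimension three; Kato 1984, (2.2)–(2.3) with
`q = ∞`: `√t ‖e^{-tA}a‖_∞ ≤ C‖a‖₃`): there is `C = C(E)` with `‖e^{τΔ}f‖_∞ ≤ C τ^{-1/2} ‖f‖₃` for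
`f ∈ L³`, `τ > 0`. [cite: Kato1984, (2.2)–(2.3)] -/
theorem exists_eLpNorm_top_heatFlow_le :
    ∃ C : ℝ≥0, ∀ (f : E → F), MemLp f 3 volume → ∀ τ : ℝ, 0 < τ →
      eLpNorm (heatFlow f τ) ∞ volume ≤ C * ENNReal.ofReal (τ ^ (-(1 / 2 : ℝ))) * eLpNorm f 3 volume := by
  obtain ⟨C, hC⟩ := UnboundedOperators.eLpNorm_heatExtension_le_rpow_holds E F (p := 3) (q := ∞)
    (by norm_num) le_top
  refine ⟨C, fun f hf τ hτ => ?_⟩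
  have h := hC f hf τ hτ
  have hexp : -((Module.finrank ℝ E : ℝ) / 2) * ((1 / (3 : ℝ≥0∞)).toReal - (1 / (∞ : ℝ≥0∞)).toReal) =
      -(1 / 2 : ℝ) := by
    rw [hE]
    norm_num [ENNReal.toReal_div]
  rw [hexp] at h
  rwa [heatFlow_of_pos _ hτ]

end Weights

end Literature.Analysis.FluidPDE
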